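import Summits.CriticalPhenomena.PercolationContinuityZ3.Theorems.PercNearOneGluingNoHeavyLowerTailHybridThreePointLBMaps
import Summits.CriticalPhenomena.PercolationContinuityZ3.Theorems.PercNearOneGluingNoHeavyLowerTailHybridThreePointLBCertificate
import Summits.CriticalPhenomena.PercolationContinuityZ3.Theorems.PercNearOneGluingNoHeavyLowerTailThreePointLBSwitching
import HarnessLib

/-!
# `NoHeavyLowerTail` (stmt-CriticalPhenomena-4575) — HYBRID / GROUP three-point lower bound by four switchings, IV:
# the certificate, the pointwise lemma `S ≤ 0`, and `E[S]` as products of probabilities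

Support file (prover prim-cert-2 gen 9; `--supports stmt-CriticalPhenomena-4575`).  No named facts, no sorries.

prim-ineq-gen-8's THEOREM-HYBRID-3PTLB (2026-08-19): for a vertex `c` ("middle pole") and vertex sets `P₁` ("b-pole"), `P₃ ⊆ P₃′`
("small/large a-poles"), with `A₁ = {P₁ ≁ c}`, `A₂ = {c ≁ P₃}`, `A₃ = {P₁ ≁ P₃′}`:  `E₃(A₁,A₂,A₃) ≥ 0` on every finite weighted graph.
This file: the O₁-free integer certificate (lit-2's Variant C with group poles) as indicators of box events of the group-connection events
`gconn` (file I) evaluated on the outputs of the group switchings `Φ₁ … Φ₄` (file II),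
  `λ₀ = [X∈Pa″][Y: P₁≁c][Z: P₃~c] + [X∈Pb′][Y: P₁~c][Z: P₃≁c] − [X∈Q′][Y: P₁≁c][Z: P₃≁c]`,
  `λ₁ = −[o₁∈Q′][o₂: P₃~c]` on `Φ₁`, `λ₂ = −[o₁: P₁~c][o₂∈Q′]` on `Φ₂`, `λ₃ = [o₁∈Pa″][o₂∈csep]` on `Φ₃`, `λ₄ = [o₁∈bSEP][o₂∈csep]` on `Φ₄`
(`Q′ = A₃∩A₁∩A₂`, `Pa″ = A₁ᶜ∩A₃`, `Pb′ = A₂ᶜ∩A₃`, `bSEP = A₃∩A₁`, `csep = A₁∩A₂`; outputs `o₁, o₂` = copies `1, 2`);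
* `cert_nonpos` — **Lemma 2 (pointwise): `S(x) ≤ 0` for every graph and every triple `x`**, only hypothesis `P₃ ⊆ P₃′`: the rewriting
  rules of file I turn every membership into the twelve atoms of file III, the group-cluster facts give its eight implications
  (`P₃ ⊆ P₃′`, transitivity through `c`, two monotonicities, F4′(ii) ×2, F4′(i) ×2), and `hcertP_nonpos` is the finite check;
* `sum_wt3W_cert` — `E[S]` = the signed sum of seven products of `PrW`'s (measure preservation of `Φᵢ` + factorisation of box events).
The assembly (linear relations among the events, the seven-atom identity, the theorem for `prodBernoulli`) is file V.
-/

noncomputable section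

namespace Summit.CriticalPhenomena.PercolationContinuityZ3.Theorems

namespace HybridThreePointLB

open Finset Literature.Probability.Percolation Literature.Probability.Percolation.DecisionTree
open Literature.Probability.Percolation.Gladkov ThreePointLB
open scoped Classical

variable {V : Type*} [Fintype V] [DecidableEq V]

/-! ### The certificate -/

section Cert

variable (c : V) (P₁ P₃ P₃' : Finset V)

/-- The pointwise certificate `S(x) = λ₀(x) + λ₁(Φ₁ x) + λ₂(Φ₂ x) + λ₃(Φ₃ x) + λ₄(Φ₄ x)` of THEOREM-HYBRID-3PTLB (module docstring),
all events written with `gconn {c} P₁ = {P₁ ~ c}`, `gconn {c} P₃ = {P₃ ~ c}`, `gconn P₃' P₁ = {P₁ ~ P₃′}`. [this work] -/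
def cert (x : Fin 3 → Finset (Sym2 V)) : ℝ :=
  ind (box (gconn {c} P₁ ∩ (gconn P₃' P₁)ᶜ) (gconn {c} P₁)ᶜ (gconn {c} P₃)) x
  + ind (box (gconn {c} P₃ ∩ (gconn P₃' P₁)ᶜ) (gconn {c} P₁) (gconn {c} P₃)ᶜ) x
  - ind (box ((gconn P₃' P₁)ᶜ ∩ ((gconn {c} P₁)ᶜ ∩ (gconn {c} P₃)ᶜ)) (gconn {c} P₁)ᶜ (gconn {c} P₃)ᶜ) x
  - ind (box Set.univ ((gconn P₃' P₁)ᶜ ∩ ((gconn {c} P₁)ᶜ ∩ (gconn {c} P₃)ᶜ)) (gconn {c} P₃)) (gphi1 P₃' x)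
  - ind (box Set.univ (gconn {c} P₁) ((gconn P₃' P₁)ᶜ ∩ ((gconn {c} P₁)ᶜ ∩ (gconn {c} P₃)ᶜ))) (gphi2 P₁ x)
  + ind (box Set.univ (gconn {c} P₁ ∩ (gconn P₃' P₁)ᶜ) ((gconn {c} P₁)ᶜ ∩ (gconn {c} P₃)ᶜ)) (gphi3 P₃' P₁ x)
  + ind (box Set.univ ((gconn P₃' P₁)ᶜ ∩ (gconn {c} P₁)ᶜ) ((gconn {c} P₁)ᶜ ∩ (gconn {c} P₃)ᶜ)) (gphi4 c P₃' x)

end Cert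

/-! ### Two more reading rules -/

/-- Targets inside the explored group are read in `X`. [this work] -/
theorem splice_mem_gconn_target_of_subset {S T : Finset V} (hTS : T ⊆ S) (X ω : Finset (Sym2 V)) (U : Finset V) :
    splice (touch (gcl X S)) X ω ∈ gconn U T ↔ X ∈ gconn U T := by
  constructor
  · rintro ⟨u, hu, t, ht, h⟩
    refine ⟨u, hu, t, ht, ?_⟩
    have h' := mem_cl_comm.1 h
    rw [cl_splice_touch_gcl (mem_gcl_of_mem (hTS ht))] at h'
    exact mem_cl_comm.1 h'
  · rintro ⟨u, hu, t, ht, h⟩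
    refine ⟨u, hu, t, ht, ?_⟩
    have h' := mem_cl_comm.1 h
    rw [← cl_splice_touch_gcl (mem_gcl_of_mem (hTS ht)) ω] at h'
    exact mem_cl_comm.1 h'

/-- The group cluster of a single vertex is its cluster. [this work] -/
theorem mem_gcl_singleton {K : Finset (Sym2 V)} {c y : V} : y ∈ gcl K {c} ↔ y ∈ cl K c := by
  rw [mem_gcl]
  constructor
  · rintro ⟨v, hv, h⟩; rw [Finset.mem_singleton] at hv; subst hv; exact h
  · intro h; exact ⟨c, Finset.mem_singleton_self c, h⟩

/-! ### The pointwise lemma -/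

/-- **Pointwise lemma** (THEOREM-HYBRID-3PTLB, Lemma 2): for every graph, every triple `x = (X, Y, Z)`, every vertex `c` and vertex sets
`P₁`, `P₃ ⊆ P₃'`: `S(x) ≤ 0`.  No disjointness hypotheses are needed. [this work] -/
theorem cert_nonpos (c : V) (P₁ P₃ P₃' : Finset V) (hP : P₃ ⊆ P₃') (x : Fin 3 → Finset (Sym2 V)) :
    cert c P₁ P₃ P₃' x ≤ 0 := by
  simp only [cert, ind_eq_pind, mem_box, gphi1_zero, gphi1_one, gphi1_two, gphi2_zero, gphi2_one, gphi2_two,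
    gphi3_zero, gphi3_one, gphi3_two, gphi4_zero, gphi4_one, gphi4_two, Set.mem_inter_iff, Set.mem_compl_iff,
    Set.mem_univ, true_and, splice_mem_gconn_root, splice_mem_gconn_target, splice_mem_gconn_target_of_subset hP]
  simp only [splice_mem_gconn_vertex]
  refine hcertP_nonpos _ _ _ _ _ _ _ _ _ _ _ _ ?_ ?_ ?_ ?_ ?_ ?_ ?_ ?_
  · -- I1: `P₃ ⊆ P₃'`
    exact fun h => mem_gconn_mono_right hP h
  · -- I2: transitivity through the vertex `c`
    exact fun hB hA => mem_gconn_trans_vertex hB hA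
  · -- I4: monotonicity
    exact fun h => mem_gconn_mono_cfg Finset.sdiff_subset h
  · -- I5: monotonicity
    exact fun h => mem_gconn_mono_cfg Finset.sdiff_subset h
  · -- I6 (F4′(ii)): a `Z`-path from `c` to `P₃` avoiding `B` survives in `X on touch B ∖ touch A′ | Z`
    rintro ⟨c', hc', t, ht, h⟩
    exact ⟨c', hc', t, ht, cl_sdiff_touch_subset_cl_splice Finset.sdiff_subset c' h⟩
  · -- I7 (F4′(i)): `c ∈ B`, `B ∩ A′ = ∅`: the `X`-cluster of `c` inside `B` stays connected in `X on touch B ∖ touch A′ | Z`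
    rintro ⟨c', hc', u, hu, huc⟩ hBA
    rw [Finset.mem_singleton] at hc'
    subst hc'
    have hsub : cl (x 0) u ⊆ gcl (x 0) P₁ := cl_subset_gcl hu
    have hdisj : ∀ y ∈ cl (x 0) u, y ∉ gcl (x 0) P₃' := by
      intro y hy hyA
      obtain ⟨v, hv, hyv⟩ := mem_gcl.1 hyA
      exact hBA ⟨v, hv, u, hu, mem_cl_trans hyv (mem_cl_comm.1 hy)⟩
    have key := cl_subset_cl_splice_sdiff_of_subset hsub hdisj (x 2) (mem_cl_comm.1 huc)
    exact ⟨c', Finset.mem_singleton_self _, u, hu, mem_cl_comm.1 key⟩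
  · -- I8 (F4′(ii)): a `Y`-path from `c` to `P₁` avoiding `A′` survives in `X on touch A′ ∖ touch C | Y`
    rintro ⟨c', hc', t, ht, h⟩
    exact ⟨c', hc', t, ht, cl_sdiff_touch_subset_cl_splice Finset.sdiff_subset c' h⟩
  · -- I9 (F4′(i)): `P₁ ~_X P₃′` through a cluster not containing `c`: it stays connected in `X on touch A′ ∖ touch C | Y`
    rintro ⟨v, hv, u, hu, huv⟩ hBc
    by_cases hcv : c ∈ cl (x 0) v
    · exact absurd ⟨c, Finset.mem_singleton_self c, u, hu, by rw [cl_eq_cl_of_mem hcv]; exact huv⟩ hBc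
    · have hsub : cl (x 0) v ⊆ gcl (x 0) P₃' := cl_subset_gcl hv
      have hdisj : ∀ y ∈ cl (x 0) v, y ∉ gcl (x 0) {c} := by
        intro y hy hyc
        rw [mem_gcl_singleton] at hyc
        exact hcv (mem_cl_trans hy (mem_cl_comm.1 hyc))
      exact ⟨v, hv, u, hu, cl_subset_cl_splice_sdiff_of_subset hsub hdisj (x 1) huv⟩

/-! ### The expectation of the certificate -/

section Expectation

variable (p : Sym2 V → ℝ) (D : Finset (Sym2 V)) (c : V) (P₁ P₃ P₃' : Finset V)

/-- `E[S] = Σᵢ E[λᵢ]`: each `E[λᵢ ∘ Φᵢ] = E[λᵢ]` by measure preservation and each `E[λᵢ]` is a product of three `PrW`'s. [this work] -/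
theorem sum_wt3W_cert :
    ∑ x ∈ triples D, wt3W D p x * cert c P₁ P₃ P₃' x =
      PrW D p (gconn {c} P₁ ∩ (gconn P₃' P₁)ᶜ) * PrW D p (gconn {c} P₁)ᶜ * PrW D p (gconn {c} P₃)
      + PrW D p (gconn {c} P₃ ∩ (gconn P₃' P₁)ᶜ) * PrW D p (gconn {c} P₁) * PrW D p (gconn {c} P₃)ᶜ
      - PrW D p ((gconn P₃' P₁)ᶜ ∩ ((gconn {c} P₁)ᶜ ∩ (gconn {c} P₃)ᶜ)) * PrW D p (gconn {c} P₁)ᶜ * PrW D p (gconn {c} P₃)ᶜ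
      - PrW D p Set.univ * PrW D p ((gconn P₃' P₁)ᶜ ∩ ((gconn {c} P₁)ᶜ ∩ (gconn {c} P₃)ᶜ)) * PrW D p (gconn {c} P₃)
      - PrW D p Set.univ * PrW D p (gconn {c} P₁) * PrW D p ((gconn P₃' P₁)ᶜ ∩ ((gconn {c} P₁)ᶜ ∩ (gconn {c} P₃)ᶜ))
      + PrW D p Set.univ * PrW D p (gconn {c} P₁ ∩ (gconn P₃' P₁)ᶜ) * PrW D p ((gconn {c} P₁)ᶜ ∩ (gconn {c} P₃)ᶜ)
      + PrW D p Set.univ * PrW D p ((gconn P₃' P₁)ᶜ ∩ (gconn {c} P₁)ᶜ) * PrW D p ((gconn {c} P₁)ᶜ ∩ (gconn {c} P₃)ᶜ) := by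
  have h1 : ∀ E₀ E₁ E₂ : Set (Finset (Sym2 V)),
      ∑ x ∈ triples D, wt3W D p x * ind (box E₀ E₁ E₂) (gphi1 P₃' x) = PrW D p E₀ * PrW D p E₁ * PrW D p E₂ :=
    fun E₀ E₁ E₂ => by rw [sum_wt3W_gphi1 p D P₃' (ind (box E₀ E₁ E₂)), sum_wt3W_ind_box]
  have h2 : ∀ E₀ E₁ E₂ : Set (Finset (Sym2 V)),
      ∑ x ∈ triples D, wt3W D p x * ind (box E₀ E₁ E₂) (gphi2 P₁ x) = PrW D p E₀ * PrW D p E₁ * PrW D p E₂ :=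
    fun E₀ E₁ E₂ => by rw [sum_wt3W_gphi2 p D P₁ (ind (box E₀ E₁ E₂)), sum_wt3W_ind_box]
  have h3 : ∀ E₀ E₁ E₂ : Set (Finset (Sym2 V)),
      ∑ x ∈ triples D, wt3W D p x * ind (box E₀ E₁ E₂) (gphi3 P₃' P₁ x) = PrW D p E₀ * PrW D p E₁ * PrW D p E₂ :=
    fun E₀ E₁ E₂ => by rw [sum_wt3W_gphi3 p D P₃' P₁ (ind (box E₀ E₁ E₂)), sum_wt3W_ind_box]
  have h4 : ∀ E₀ E₁ E₂ : Set (Finset (Sym2 V)),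
      ∑ x ∈ triples D, wt3W D p x * ind (box E₀ E₁ E₂) (gphi4 c P₃' x) = PrW D p E₀ * PrW D p E₁ * PrW D p E₂ :=
    fun E₀ E₁ E₂ => by rw [sum_wt3W_gphi4 p D c P₃' (ind (box E₀ E₁ E₂)), sum_wt3W_ind_box]
  simp only [cert, mul_add, mul_sub, Finset.sum_add_distrib, Finset.sum_sub_distrib, sum_wt3W_ind_box, h1, h2, h3, h4]

end Expectation

end HybridThreePointLB

end Summit.CriticalPhenomena.PercolationContinuityZ3.Theorems

end
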